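import Mathlib

/-!
# The Borwein–Dobrowolski–Mossinghoff auxiliary polynomial `(y² + 1)(y² - 1)⁴` (venture `DiscreteObjects`, target L)

Cell `pub-namedobj`, seat `pub-namedobj-mahler` (gen 8). Framing: lottery ticket; floor = certified
bounds/negative ranges.

[BDM07, Cor. 3.4] uses the auxiliary polynomial `F(y) = (1 + y²)(1 - y²)⁴`, for which
`ν(F) = 9`, `deg F = 10` and `‖F‖_∞ = 2⁹ / (25 √5)` (sup norm on the unit circle).  This file proves the
pointwise archimedean estimate that replaces BDM's Lemma 3.2 (`L(F^k)^{1/k} → ‖F‖_∞`) by the maximum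
modulus principle:

* `bdm_poly_ineq` — `(1 - t) t⁴ ≤ 256/3125` for `t ≥ 0`
  (`3125 t⁵ - 3125 t⁴ + 256 = (5t - 4)² (125 t³ + 75 t² + 40 t + 16)`);
* `normSq_bdmAux_le_of_norm_eq_one` — on the unit circle `‖F(z)‖² = 2¹⁰ x² y⁸ ≤ 2¹⁸/5⁵`
  (`z = x + iy`);
* `norm_bdmAux_sq_le` — for every `β ∈ ℂ`: `‖(β² + 1)(β² - 1)⁴‖² ≤ (2¹⁸/5⁵) · max(1, ‖β‖)²⁰`
  (maximum modulus on the closed disc, and `F(β) = β¹⁰ F(1/β)` outside it).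
-/

namespace Summit.Ventures.DiscreteObjects.Mahler

open Complex

/-- `(1 - t) t⁴ ≤ 4⁴/5⁵` for `t ≥ 0` (maximum at `t = 4/5`). -/
theorem bdm_poly_ineq {t : ℝ} (ht : 0 ≤ t) : (1 - t) * t ^ 4 ≤ 256 / 3125 := by
  have h : 0 ≤ (5 * t - 4) ^ 2 * (125 * t ^ 3 + 75 * t ^ 2 + 40 * t + 16) := by positivity
  nlinarith [h]

/-- On the unit circle, `|z² + 1|² = 4 (Re z)²`. -/
theorem normSq_sq_add_one_of_norm_eq_one {z : ℂ} (hz : ‖z‖ = 1) :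
    normSq (z ^ 2 + 1) = 4 * z.re ^ 2 := by
  have hxy : z.re ^ 2 + z.im ^ 2 = 1 := by
    have h := normSq_eq_norm_sq z
    rw [hz, one_pow, normSq_apply] at h
    nlinarith [h]
  simp only [normSq_apply, pow_two, add_re, mul_re, one_re, add_im, mul_im, one_im]
  linear_combination (z.re ^ 2 + z.im ^ 2 - 1) * hxy

/-- On the unit circle, `|z² - 1|² = 4 (Im z)²`. -/
theorem normSq_sq_sub_one_of_norm_eq_one {z : ℂ} (hz : ‖z‖ = 1) :
    normSq (z ^ 2 - 1) = 4 * z.im ^ 2 := by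
  have hxy : z.re ^ 2 + z.im ^ 2 = 1 := by
    have h := normSq_eq_norm_sq z
    rw [hz, one_pow, normSq_apply] at h
    nlinarith [h]
  simp only [normSq_apply, pow_two, sub_re, mul_re, one_re, sub_im, mul_im, one_im]
  linear_combination (z.re ^ 2 + z.im ^ 2 - 1) * hxy

/-- **Sup norm of the BDM auxiliary polynomial.** For `‖z‖ = 1`,
`‖(z² + 1)(z² - 1)⁴‖² ≤ 2¹⁸/5⁵` (`= (2⁹/(25√5))²`, [BDM07, proof of Cor. 3.4]). -/
theorem normSq_bdmAux_le_of_norm_eq_one {z : ℂ} (hz : ‖z‖ = 1) :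
    ‖(z ^ 2 + 1) * (z ^ 2 - 1) ^ 4‖ ^ 2 ≤ 2 ^ 18 / 5 ^ 5 := by
  have hxy : z.re ^ 2 + z.im ^ 2 = 1 := by
    have h := normSq_eq_norm_sq z
    rw [hz, one_pow, normSq_apply] at h
    nlinarith [h]
  rw [← normSq_eq_norm_sq, map_mul, map_pow, normSq_sq_add_one_of_norm_eq_one hz,
    normSq_sq_sub_one_of_norm_eq_one hz]
  have ht := bdm_poly_ineq (sq_nonneg z.im)
  have hre : z.re ^ 2 = 1 - z.im ^ 2 := by linarith
  rw [hre]
  have h4 : (4 * z.im ^ 2) ^ 4 = 256 * (z.im ^ 2) ^ 4 := by ring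
  rw [h4]
  nlinarith [ht, sq_nonneg z.im]

/-- The self-reciprocity `F(β) = β¹⁰ F(1/β)` of the BDM auxiliary polynomial. -/
theorem bdmAux_eq_pow_mul_inv {β : ℂ} (hβ : β ≠ 0) :
    (β ^ 2 + 1) * (β ^ 2 - 1) ^ 4 = β ^ 10 * ((β⁻¹ ^ 2 + 1) * (β⁻¹ ^ 2 - 1) ^ 4) := by
  field_simp
  ring

/-- **Maximum modulus.** For `‖β‖ ≤ 1`: `‖(β² + 1)(β² - 1)⁴‖ ≤ √(2¹⁸/5⁵)`. -/
theorem norm_bdmAux_le_of_norm_le_one {β : ℂ} (hβ : ‖β‖ ≤ 1) :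
    ‖(β ^ 2 + 1) * (β ^ 2 - 1) ^ 4‖ ≤ Real.sqrt (2 ^ 18 / 5 ^ 5) := by
  have hd : DiffContOnCl ℂ (fun z : ℂ => (z ^ 2 + 1) * (z ^ 2 - 1) ^ 4) (Metric.ball (0 : ℂ) 1) :=
    Differentiable.diffContOnCl (by fun_prop)
  have hfr : ∀ z ∈ frontier (Metric.ball (0 : ℂ) 1),
      ‖(fun z : ℂ => (z ^ 2 + 1) * (z ^ 2 - 1) ^ 4) z‖ ≤ Real.sqrt (2 ^ 18 / 5 ^ 5) := by
    intro z hz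
    rw [frontier_ball (0 : ℂ) one_ne_zero, mem_sphere_zero_iff_norm] at hz
    calc ‖(fun z : ℂ => (z ^ 2 + 1) * (z ^ 2 - 1) ^ 4) z‖
        = Real.sqrt (‖(z ^ 2 + 1) * (z ^ 2 - 1) ^ 4‖ ^ 2) := (Real.sqrt_sq (norm_nonneg _)).symm
      _ ≤ Real.sqrt (2 ^ 18 / 5 ^ 5) := Real.sqrt_le_sqrt (normSq_bdmAux_le_of_norm_eq_one hz)
  have hcl : β ∈ closure (Metric.ball (0 : ℂ) 1) := by
    rw [closure_ball (0 : ℂ) one_ne_zero, Metric.mem_closedBall, dist_zero_right]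
    exact hβ
  exact Complex.norm_le_of_forall_mem_frontier_norm_le Metric.isBounded_ball hd hfr hcl

/-- For every `β ∈ ℂ`: `‖(β² + 1)(β² - 1)⁴‖ ≤ √(2¹⁸/5⁵) · max(1, ‖β‖)¹⁰`. -/
theorem norm_bdmAux_le (β : ℂ) :
    ‖(β ^ 2 + 1) * (β ^ 2 - 1) ^ 4‖ ≤ Real.sqrt (2 ^ 18 / 5 ^ 5) * max 1 ‖β‖ ^ 10 := by
  have hK : 0 ≤ Real.sqrt (2 ^ 18 / 5 ^ 5) := Real.sqrt_nonneg _
  have hm1 : 1 ≤ max 1 ‖β‖ := le_max_left _ _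
  rcases le_or_gt ‖β‖ 1 with hle | hlt
  · calc ‖(β ^ 2 + 1) * (β ^ 2 - 1) ^ 4‖ ≤ Real.sqrt (2 ^ 18 / 5 ^ 5) :=
          norm_bdmAux_le_of_norm_le_one hle
      _ = Real.sqrt (2 ^ 18 / 5 ^ 5) * 1 := (mul_one _).symm
      _ ≤ Real.sqrt (2 ^ 18 / 5 ^ 5) * max 1 ‖β‖ ^ 10 :=
          mul_le_mul_of_nonneg_left (one_le_pow₀ hm1) hK
  · have hβ0 : β ≠ 0 := by
      intro h; rw [h, norm_zero] at hlt; exact absurd hlt (by norm_num)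
    have hinv : ‖β⁻¹‖ ≤ 1 := by
      rw [norm_inv]; exact inv_le_one_of_one_le₀ hlt.le
    have hmax : max 1 ‖β‖ = ‖β‖ := max_eq_right hlt.le
    rw [bdmAux_eq_pow_mul_inv hβ0, norm_mul, norm_pow, hmax, mul_comm]
    exact mul_le_mul_of_nonneg_right (norm_bdmAux_le_of_norm_le_one hinv) (by positivity)

/-- **Archimedean estimate for the BDM auxiliary polynomial** (squared, rational constants): for every
`β ∈ ℂ`, `‖(β² + 1)(β² - 1)⁴‖² ≤ (2¹⁸/5⁵) · max(1, ‖β‖)²⁰`. -/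
theorem norm_bdmAux_sq_le (β : ℂ) :
    ‖(β ^ 2 + 1) * (β ^ 2 - 1) ^ 4‖ ^ 2 ≤ 2 ^ 18 / 5 ^ 5 * max 1 ‖β‖ ^ 20 := by
  have h := norm_bdmAux_le β
  have h2 := pow_le_pow_left₀ (norm_nonneg _) h 2
  have hK2 : Real.sqrt (2 ^ 18 / 5 ^ 5) ^ 2 = 2 ^ 18 / 5 ^ 5 := Real.sq_sqrt (by positivity)
  calc ‖(β ^ 2 + 1) * (β ^ 2 - 1) ^ 4‖ ^ 2 ≤ (Real.sqrt (2 ^ 18 / 5 ^ 5) * max 1 ‖β‖ ^ 10) ^ 2 := h2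
    _ = 2 ^ 18 / 5 ^ 5 * max 1 ‖β‖ ^ 20 := by rw [mul_pow, hK2]; ring

end Summit.Ventures.DiscreteObjects.Mahler
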